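import Mathlib.Data.Int.Interval
import Literature.IUT.HodgeArakelov.ThetaSubgraphNorm
import Literature.IUT.HodgeArakelov.ThetaEvaluationSubgraphs
import HarnessLib

/-!
# [IUTchII] Remark 2.6.3 (ii) (c), (iv), (v): fibers of `Γ'` over `|F_l|` and the distinguished values `q^{j²}` — proofs

S. Mochizuki, *Inter-universal Teichmüller theory II*, §2, Remark 2.6.3 (kurims manuscript pp. 79–80),
Remark 2.1.1 (ii) (p. 65: `Γ^▶_Ÿ = [−l⋇, l⋇]`, stabilized by the inversion `ι`) and Remark 2.5.1 (i) (p. 72: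
the theta values `θ^j = μ_{2l} · q^{j²}`) [cite: Mochizuki2012, Rmk 2.6.3 p.79]. PROOF-ONLY companion
(abc-iut cell, node ids `IUTchII:Rmk2.6.3(ii)`, `(iv)`, `(v)`) of the typer's `ThetaSubgraphNorm`
(`absLabel`, `fiber`, `labelCount = |Γ'|`, `interval a b = [-a, b]`) and `ThetaEvaluationSubgraphs`
(`thetaValueAt`); no new definitions; `l = 2l⋇ + 1` is written `2 * lstar + 1` where parity matters.
Sibling file `ThetaSubgraphNormProofs` treats (i), (ii) (d), (iii). Claim key DISPUTED (D-0012):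
elementary combinatorics of the PRINTED definitions; no side taken.

**Proved.**
* (ii) (c): the «min» in `‖Γ'‖` ranges over a fiber of `ℤ ↠ |F_l|` restricted to `Γ'` (`mem_fiber_iff`),
  and such a fiber may carry TWO values `j̲²`: `l⋇` and `l⋇+1` share the label `l⋇`
  (`absLabel_half_add_one`, `two_values_in_fiber_of_half_lt`) — "one cannot restrict the étale theta
  function to «one `j̲ ∈ Γ'`» without also restricting … to the various «other `j̲ ∈ Γ'`» that lie in the
  same fiber".
* (iv), (v) under the READING "a fiber of `Γ'` over `|F_l|` contains more than one element" = "carries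
  more than one value `j̲²`" — READING TOKEN, kernel-certified: read literally the clause is met by `Γ^▶_Ÿ`
  itself, whose nonzero fibers are the two-element sets `{±j}` (`fiber_gammaArrow`,
  `card_fiber_gammaArrow`) carrying one value (`singleValued_gammaArrow`). Under the reading: a connected
  `Γ' = [-a,b] ∋ 0` with single-valued fibers lies in `Γ^▶_Ÿ` (`le_half_of_singleValued`); if moreover
  `|Γ'| = l⋇` is maximal, its collection of values `{|j̲|}` — hence of theta values `q^{j̲²}` — EQUALS that
  of `Γ^▶_Ÿ` (`image_natAbs_eq_of_singleValued`: "essentially determined by the requirement of maximizing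
  `‖Γ'‖` in a fashion compatible with the global product formula"), and if `ι`-stable it IS `Γ^▶_Ÿ`
  (`eq_gammaArrow_of_singleValued_of_symm`: "the only choice for `Γ'`"); conversely `Γ^▶_Ÿ` has all these
  properties (`neg_mem_gammaArrow`, `labelCount_interval`).
* Link (v) ↔ Rmk 2.5.1 (i): the value `q^{j̲²}` at a vertex `j̲ ∈ Γ^▶_Ÿ` lies in the theta-value orbit
  `θ^{|j̲|}` of its label (`pow_sq_mem_thetaValueAt_absLabel`).
-/

namespace Literature.IUT.HodgeArakelov

namespace SubgraphNorm

open scoped BigOperators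

/-! ### (ii) (c): the «min» ranges over a fiber of `ℤ ↠ |F_l|` restricted to `Γ'`; fibers may carry two values -/

variable {l : ℕ}

/-- **Rmk 2.6.3 (ii) (c)**: "the set of «`j̲`'s» that occur in the «min» … is always equal to a fiber of the
restriction to the set of vertices of `Γ'` of the natural projection `ℤ ↠ |F_l|`".
[cite: Mochizuki2012, Rmk 2.6.3 (ii) p.79] -/
theorem mem_fiber_iff (Γ : Finset ℤ) (j : ℕ) (z : ℤ) :
    z ∈ fiber l Γ j ↔ z ∈ Γ ∧ absLabel l z = j := Finset.mem_filter

/-- For `|z| ≤ l⋇` the label of `z` is `|z|` (the vertices of `Γ^▶_Ÿ = [-l⋇, l⋇]` are their own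
least-absolute-value representatives; Rmk 2.8.3 (i)). [cite: Mochizuki2012, Rmk 2.6.3 (ii) p.79] -/
theorem absLabel_eq_natAbs_of_le {z : ℤ} (hz : z.natAbs ≤ l / 2) : absLabel l z = z.natAbs := by
  rcases Int.natAbs_eq z with h | h
  · rw [h, Int.natAbs_natCast]; exact absLabel_natCast hz
  · rw [h, absLabel_neg, Int.natAbs_neg, Int.natAbs_natCast]; exact absLabel_natCast hz

/-- The vertex `l⋇ + 1` (just outside `Γ^▶_Ÿ`) has label `l⋇`, the same as the vertex `l⋇`: `l⋇ + 1 ≡ -l⋇`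
modulo `l = 2l⋇ + 1`. [cite: Mochizuki2012, Rmk 2.6.3 (ii) p.79] -/
theorem absLabel_half_add_one (lstar : ℕ) (h : 1 ≤ lstar) :
    absLabel (2 * lstar + 1) ((lstar : ℤ) + 1) = lstar := by
  unfold absLabel
  have hcast : (((lstar : ℤ) + 1 : ℤ) : ZMod (2 * lstar + 1)) = ((lstar + 1 : ℕ) : ZMod (2 * lstar + 1)) := by
    push_cast; rfl
  have hval : ((lstar + 1 : ℕ) : ZMod (2 * lstar + 1)).val = lstar + 1 := by
    rw [ZMod.val_natCast]; exact Nat.mod_eq_of_lt (by omega)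
  rw [hcast, ZMod.valMinAbs_def_pos, hval]
  have hdiv : (2 * lstar + 1) / 2 = lstar := by omega
  rw [hdiv, if_neg (by omega)]
  omega

/-- **Rmk 2.6.3 (ii) (c) / (iv), a fiber with two values**: once `Γ' = [-a, b]` reaches `b ≥ l⋇ + 1`, the
fiber over the label `l⋇` contains both `l⋇` and `l⋇ + 1`, whose squares differ — "one cannot restrict the
étale theta function to «one `j̲ ∈ Γ'`» without also restricting … to the various «other `j̲ ∈ Γ'`» that lie in
the same fiber over `|F_l|`". [cite: Mochizuki2012, Rmk 2.6.3 (ii) p.80] -/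
theorem two_values_in_fiber_of_half_lt (lstar a b : ℕ) (h : 1 ≤ lstar) (hb : lstar + 1 ≤ b) :
    (lstar : ℤ) ∈ fiber (2 * lstar + 1) (interval a b) lstar ∧
      (lstar : ℤ) + 1 ∈ fiber (2 * lstar + 1) (interval a b) lstar ∧
        ((lstar : ℤ)).natAbs ^ 2 ≠ ((lstar : ℤ) + 1).natAbs ^ 2 := by
  refine ⟨?_, ?_, ?_⟩
  · rw [mem_fiber_iff]
    refine ⟨by simp [interval]; omega, absLabel_natCast (by omega)⟩
  · rw [mem_fiber_iff]
    exact ⟨by simp [interval]; omega, absLabel_half_add_one lstar h⟩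
  · have h1 : ((lstar : ℤ) + 1).natAbs = lstar + 1 := by omega
    rw [Int.natAbs_natCast, h1]
    intro heq
    have := Nat.pow_lt_pow_left (show lstar < lstar + 1 by omega) (two_ne_zero)
    omega

/-! ### (iv), (v): single-valued fibers and the distinguished collection `{q^{j²}}` of `Γ^▶_Ÿ` -/

/-- The fibers of `Γ^▶_Ÿ = [-l⋇, l⋇]` over a nonzero label `j` are the two-element sets `{j, -j}` — the
READING TOKEN for (iv): read literally, "a fiber of `Γ'` over `|F_l|` contains more than one element" holds
for `Γ^▶_Ÿ` itself; what such a fiber does NOT carry is more than one VALUE `j̲²`.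
[cite: Mochizuki2012, Rmk 2.6.3 (iv) p.80] -/
theorem fiber_gammaArrow (lstar : ℕ) {j : ℕ} (hj1 : 1 ≤ j) (hj : j ≤ lstar) :
    fiber (2 * lstar + 1) (interval lstar lstar) j = {(j : ℤ), -(j : ℤ)} := by
  have hl2 : (2 * lstar + 1) / 2 = lstar := by omega
  ext z
  rw [mem_fiber_iff]
  simp only [interval, Finset.mem_Icc, Finset.mem_insert, Finset.mem_singleton]
  constructor
  · rintro ⟨hz, hlab⟩
    have hzabs : z.natAbs ≤ (2 * lstar + 1) / 2 := by rw [hl2]; omega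
    rw [absLabel_eq_natAbs_of_le hzabs] at hlab
    omega
  · rintro (rfl | rfl)
    · exact ⟨by omega, absLabel_natCast (by omega)⟩
    · exact ⟨by omega, by rw [absLabel_neg]; exact absLabel_natCast (by omega)⟩

/-- Each nonzero fiber of `Γ^▶_Ÿ` has exactly TWO elements (literal reading of (iv) fails at `Γ^▶_Ÿ`).
[cite: Mochizuki2012, Rmk 2.6.3 (iv) p.80] -/
theorem card_fiber_gammaArrow (lstar : ℕ) {j : ℕ} (hj1 : 1 ≤ j) (hj : j ≤ lstar) :
    (fiber (2 * lstar + 1) (interval lstar lstar) j).card = 2 := by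
  rw [fiber_gammaArrow lstar hj1 hj, Finset.card_pair]
  omega

/-- … but ONE value: on `Γ^▶_Ÿ` two vertices with the same label have the same square ("single-valued
fibers" — the reading of (iv) under which `Γ^▶_Ÿ` is compatible with the product formula).
[cite: Mochizuki2012, Rmk 2.6.3 (iv) p.80] -/
theorem singleValued_gammaArrow (lstar : ℕ) (j : ℕ) (z w : ℤ)
    (hz : z ∈ fiber (2 * lstar + 1) (interval lstar lstar) j)
    (hw : w ∈ fiber (2 * lstar + 1) (interval lstar lstar) j) : z.natAbs = w.natAbs := by
  have hl2 : (2 * lstar + 1) / 2 = lstar := by omega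
  rw [mem_fiber_iff] at hz hw
  simp only [interval, Finset.mem_Icc] at hz hw
  have hz' : z.natAbs ≤ (2 * lstar + 1) / 2 := by rw [hl2]; omega
  have hw' : w.natAbs ≤ (2 * lstar + 1) / 2 := by rw [hl2]; omega
  rw [← absLabel_eq_natAbs_of_le hz', ← absLabel_eq_natAbs_of_le hw', hz.2, hw.2]

/-- **Rmk 2.6.3 (iv), the constraint**: if every fiber of `Γ' = [-a, b]` over `|F_l|` carries a single value
`j̲²` ("compatible with the product formula"), then `Γ' ⊆ Γ^▶_Ÿ`, i.e. `a, b ≤ l⋇` (else the fiber over `l⋇`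
carries `l⋇²` and `(l⋇+1)²`). [cite: Mochizuki2012, Rmk 2.6.3 (iv) p.80] -/
theorem le_half_of_singleValued (lstar a b : ℕ) (h : 1 ≤ lstar)
    (hsv : ∀ j : ℕ, ∀ z w : ℤ, z ∈ fiber (2 * lstar + 1) (interval a b) j →
      w ∈ fiber (2 * lstar + 1) (interval a b) j → z.natAbs = w.natAbs) :
    a ≤ lstar ∧ b ≤ lstar := by
  constructor
  · by_contra ha
    push Not at ha
    have h1 : -(lstar : ℤ) ∈ fiber (2 * lstar + 1) (interval a b) lstar := by
      rw [mem_fiber_iff]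
      exact ⟨by simp [interval]; omega, by rw [absLabel_neg]; exact absLabel_natCast (by omega)⟩
    have h2 : -((lstar : ℤ) + 1) ∈ fiber (2 * lstar + 1) (interval a b) lstar := by
      rw [mem_fiber_iff]
      exact ⟨by simp [interval]; omega, by rw [absLabel_neg]; exact absLabel_half_add_one lstar h⟩
    have := hsv _ _ _ h1 h2
    omega
  · by_contra hb
    push Not at hb
    obtain ⟨h1, h2, _⟩ := two_values_in_fiber_of_half_lt lstar a b h (by omega)
    have := hsv _ _ _ h1 h2
    omega

/-- The collection of absolute values `|j̲|`, `j̲ ∈ [-a, b]`, is `{0, …, max a b}`; so the "collection of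
`q^{j̲²}`" of Rmk 2.6.3 (i)/(v) attached to `[-a, b]` is `{q^{j²} : 0 ≤ j ≤ max a b}`.
[cite: Mochizuki2012, Rmk 2.6.3 (v) p.80] -/
theorem image_natAbs_interval (a b : ℕ) :
    (interval a b).image Int.natAbs = Finset.range (max a b + 1) := by
  ext n
  simp only [Finset.mem_image, Finset.mem_range]
  constructor
  · rintro ⟨z, hz, rfl⟩
    have := natAbs_le_of_mem_interval hz
    omega
  · intro hn
    obtain ⟨z, hz, hzn, -⟩ := exists_rep_mem_interval (a := a) (b := b) (j := n) (by omega)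
    exact ⟨z, hz, hzn⟩

/-- **Rmk 2.6.3 (v), "essentially determined by the requirement of maximizing `‖Γ'‖` in a fashion compatible
with the global product formula"**: an admissible `Γ' = [-a, b]` with single-valued fibers and maximal
`|Γ'| = l⋇` has the SAME collection of values `{|j̲|} = {0, …, l⋇}` — hence the same theta values `q^{j²}`
— as `Γ^▶_Ÿ`. [cite: Mochizuki2012, Rmk 2.6.3 (v) p.80] -/
theorem image_natAbs_eq_of_singleValued (lstar a b : ℕ) (h : 1 ≤ lstar)
    (hsv : ∀ j : ℕ, ∀ z w : ℤ, z ∈ fiber (2 * lstar + 1) (interval a b) j →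
      w ∈ fiber (2 * lstar + 1) (interval a b) j → z.natAbs = w.natAbs)
    (hmax : labelCount (2 * lstar + 1) (interval a b) = lstar) :
    (interval a b).image Int.natAbs = (interval lstar lstar).image Int.natAbs := by
  obtain ⟨ha, hb⟩ := le_half_of_singleValued lstar a b h hsv
  have hl2 : (2 * lstar + 1) / 2 = lstar := by omega
  rw [labelCount_interval, hl2] at hmax
  rw [image_natAbs_interval, image_natAbs_interval, max_self]
  congr 1
  omega

/-- **Rmk 2.6.3 (iv), "the only choice for `Γ'` … is `Γ^▶_Ÿ`"**: an admissible `Γ' = [-a, b]` with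
single-valued fibers, maximal `|Γ'| = l⋇`, and stable under the inversion `ι : j̲ ↦ -j̲` of `Γ_Ÿ` (Rmk 2.1.1 (ii))
IS `Γ^▶_Ÿ = [-l⋇, l⋇]`. [cite: Mochizuki2012, Rmk 2.6.3 (iv) p.80] -/
theorem eq_gammaArrow_of_singleValued_of_symm (lstar a b : ℕ) (h : 1 ≤ lstar)
    (hsv : ∀ j : ℕ, ∀ z w : ℤ, z ∈ fiber (2 * lstar + 1) (interval a b) j →
      w ∈ fiber (2 * lstar + 1) (interval a b) j → z.natAbs = w.natAbs)
    (hmax : labelCount (2 * lstar + 1) (interval a b) = lstar)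
    (hsymm : ∀ z : ℤ, z ∈ interval a b → -z ∈ interval a b) :
    interval a b = interval lstar lstar := by
  obtain ⟨ha, hb⟩ := le_half_of_singleValued lstar a b h hsv
  have hl2 : (2 * lstar + 1) / 2 = lstar := by omega
  rw [labelCount_interval, hl2] at hmax
  have h1 := hsymm (-(a : ℤ)) (by simp [interval])
  have h2 := hsymm (b : ℤ) (by simp [interval])
  simp only [interval, Finset.mem_Icc, neg_neg] at h1 h2
  have hab : a = b := by omega
  have : a = lstar := by
    subst hab; rw [max_self] at hmax; omega
  subst hab; subst this; rfl

/-- Conversely `Γ^▶_Ÿ` is `ι`-stable. [cite: Mochizuki2012, Rmk 2.6.3 (iv) p.80] -/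
theorem neg_mem_gammaArrow (lstar : ℕ) {z : ℤ} (hz : z ∈ interval lstar lstar) :
    -z ∈ interval lstar lstar := by
  simp only [interval, Finset.mem_Icc] at hz ⊢; omega

/-! ### Link with the theta values of Remark 2.5.1 (i) / Corollary 2.5 -/

section ThetaValues

variable {H : Type*} [CommGroup H] [DecidableEq H] (twoL : ℕ) [Fintype (rootsOfUnity twoL H)]

/-- The value `q^{j̲²}` lies in the theta-value orbit `θ^{|j̲|} = μ_{2l} · q^{|j̲|²}` of Remark 2.5.1 (i).
[cite: Mochizuki2012, Rmk 2.5.1 (i) p.72] -/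
theorem pow_natAbs_sq_mem_thetaValueAt (q : H) (z : ℤ) :
    q ^ (z.natAbs ^ 2) ∈ thetaValueAt twoL q z.natAbs :=
  (mem_thetaValueAt twoL q z.natAbs _).mpr ⟨1, by simp⟩

/-- **Rmk 2.6.3 (i)/(v) ↔ Rmk 2.5.1 (i)**: for a vertex `j̲` of `Γ^▶_Ÿ = [-l⋇, l⋇]` the value `q^{j̲²}` "obtained by
allowing `j̲ ∈ ℤ` to range over the «vertices» of `Γ'`" lies in the theta-value orbit `θ^{j}` of ITS LABEL
`j = |j̲| ∈ |F_l|` — the collection `{q^{j²}}` of (v) is the set of orbit representatives of Cor 2.5 (ii).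
[cite: Mochizuki2012, Rmk 2.6.3 (v) p.80] -/
theorem pow_sq_mem_thetaValueAt_absLabel (q : H) {z : ℤ} (hz : z ∈ interval (l / 2) (l / 2)) :
    q ^ (z.natAbs ^ 2) ∈ thetaValueAt twoL q (absLabel l z) := by
  have hzabs : z.natAbs ≤ l / 2 := by
    have := natAbs_le_of_mem_interval hz; rwa [max_self] at this
  rw [absLabel_eq_natAbs_of_le hzabs]
  exact pow_natAbs_sq_mem_thetaValueAt twoL q z

/-- **Rmk 2.6.3 (v) at the level of the theta values themselves** (v2 addendum): under the hypotheses of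
`image_natAbs_eq_of_singleValued` (single-valued fibers, maximal `|Γ'| = l⋇`), the "collection of values
`q^{j̲²}`" attached to `Γ' = [-a, b]` inside the cohomology module `H` of Remark 2.5.1 (i) EQUALS the
collection attached to `Γ^▶_Ÿ = [-l⋇, l⋇]` — for every `q` ("`q_v`"), with no hypothesis on its order.
[cite: Mochizuki2012, Rmk 2.6.3 (v) p.80] -/
theorem values_eq_of_singleValued (q : H) (lstar a b : ℕ) (h : 1 ≤ lstar)
    (hsv : ∀ j : ℕ, ∀ z w : ℤ, z ∈ fiber (2 * lstar + 1) (interval a b) j →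
      w ∈ fiber (2 * lstar + 1) (interval a b) j → z.natAbs = w.natAbs)
    (hmax : labelCount (2 * lstar + 1) (interval a b) = lstar) :
    (interval a b).image (fun z : ℤ => q ^ (z.natAbs ^ 2)) =
      (interval lstar lstar).image (fun z : ℤ => q ^ (z.natAbs ^ 2)) := by
  have hcomp : (fun z : ℤ => q ^ (z.natAbs ^ 2)) = (fun n : ℕ => q ^ (n ^ 2)) ∘ Int.natAbs := rfl
  rw [hcomp, ← Finset.image_image, ← Finset.image_image,
    image_natAbs_eq_of_singleValued lstar a b h hsv hmax]

/-- … and these values all lie in the union of the theta-value orbits `θ^{j}`, `0 ≤ j ≤ l⋇`, of Cor 2.5 (ii) /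
Remark 2.5.1 (i) (v2 addendum). [cite: Mochizuki2012, Rmk 2.6.3 (v) p.80] -/
theorem values_gammaArrow_subset_thetaValues (q : H) (lstar : ℕ) :
    ∀ x ∈ (interval lstar lstar).image (fun z : ℤ => q ^ (z.natAbs ^ 2)),
      ∃ j ≤ lstar, x ∈ thetaValueAt twoL q j := by
  intro x hx
  obtain ⟨z, hz, rfl⟩ := Finset.mem_image.mp hx
  refine ⟨z.natAbs, ?_, pow_natAbs_sq_mem_thetaValueAt twoL q z⟩
  have := natAbs_le_of_mem_interval hz
  rwa [max_self] at this

end ThetaValues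

end SubgraphNorm

end Literature.IUT.HodgeArakelov
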